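import Literature.MathematicalPhysics.QuantumFieldTheory.Balaban1983to89.B9Delta2FormMajorant
import Literature.MathematicalPhysics.QuantumFieldTheory.Balaban1983to89.B9PerturbationL2Delta2
import Literature.MathematicalPhysics.QuantumFieldTheory.Balaban1983to89.B9RWSums347DefiniteFaces
import Literature.MathematicalPhysics.QuantumFieldTheory.Balaban1983to89.B9RowSum261DefiniteFaces
import Literature.MathematicalPhysics.QuantumFieldTheory.Balaban1983to89.B9RWSumsDefinitePins

/-!
# BalabanUVNodes ∕ N06 ([B9], `Dag.B9_main`) — THE RESIDUAL LETTERS `hD2sup` (ed. 30) ∕ `hD2L2` (ed. 29) OF THE STAGE-11 CERTIFICATE AT def-Y's GENUINE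
# RESIDUAL `𝔯 := resYOfC2 N θ M⋆ 𝔠` ((3.134) as a function of [5]'s `C⁽²⁾`), DERIVED AT THE PINS FROM TWO DISPLAYED PRINT LETTERS: [5] (149) for `C⁽²⁾` and
# «|(H\*J)(b)| ≦ O(1)Mα₀(Lʲη)⁻³» (p. 422)

Track A of `YM-PLAN.md` (cell `pub-ymgap`, HUMAN RULING D-0062), node **N06** = [Balaban1985BackgroundPropagators] Thms 3.1–3.15; WIDTH-209, seat
`pub-ymgap-dag-n06-w8` (g2), 2026-08-28; the LOCATED-(B) line of seat g0 (cell bus I.31859) typed.  A HELPER for the stage-11 certificate editions ≥ 29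
(`…N06AtOpsYNuOfRecordV6EPairNJ`, binder `hD2L2` l.194; edition 30's optional trade `hD2L2 ↦ hD2sup` by n06-w8 g0's `B9PerturbationL2Delta2.blockBd_d2coK_of_sup_symm`).
WHAT.  The certificate is stated for a residual PARAMETER `𝔯 : ResY N θ M⋆` and displays print's (3.137) about it: `hD2sup ∕ hD2L2 : ∀ x, M ≤ M_x → ∀ α₀ > 0,
M_xα₀ ≤ a → ∀ U, Reg335 → Reg336 → HasMajorant ∕ BlockBd … (D2coK x.toKIdx (trBasis N) 𝔅x id ((𝔯 x).Δ2) U) (θ₂·(M_xα₀)·(Lʲη)⁻²·e^{−δ₂d} ∕ θ₂·(M_xα₀)·(Lʲη)⁻¹(L^{j′}η)⁻¹·e^{−δ₂d})`.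
def-Y's `Node00.OpsYDelta2Form` supplies THE residual of record `𝔯 := resYOfC2 N θ M⋆ 𝔠` — (3.134)'s `Δ⁽²⁾(U)` as a FUNCTION of [5]'s second-order form letter
`𝔠 : C2Y N θ M⋆` (the one external parameter left) — and n06-w8 g2's `B9Delta2FormMajorant.hasMajorant_coordOpK_delta2OfY` proves (3.137)'s [4]-(2.51) majorant
for `delta2OfY` from the two letters print names on p. 422.  THIS FILE pins that theorem to the certificate's data:
★★ `hD2sup_of_form_schemas` — inputs: the primitive constants `q : PinPrims` (member facts `lemma21Pack_geo9Y` at ((1−2α)δ₀, α_F) and [4] (2.61) `rowSum261_geo9Y`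
at the rate `ρ_R`, each above ONE threshold), the pin `hblk12 : (𝔬12 x).blk = blkBK x.toKIdx (bI x)`, the DISPLAYED LETTERS `hC2` ([5] (149) ∕ p. 423 «several
j-blocks surrounding Δ(y)»: `C2FormMaj x.toKIdx (bI x) id (𝔠 x).form U κ_C δ_C (Lʲη)^{+1}` in the regime) and `hHJ` (p. 422: `‖(H(U)†J(U))(c)‖ ≦ t_{HJ}·(M_xα₀)·(Lʲη)⁻³`,
H = def-Y's `HDY` of (3.126) over the tables of record, J = r06's (3.11) current `JY`, `†` = def-Y's trace transpose `trAdjY`), the rate budget `δ₂ + α_F(1−2α)δ₀ + ρ_R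
≦ δ_C` and ONE displayed constant `θ₂ ≧ (cR39 (trBasis N))⁻¹·2N·(basisBound39 (trBasis N))²·κ_C·t_{HJ}·(ℓ+1)²·rowConst261 geo9Y ρ_R`; output: `∃ ML`, and above it
edition 30's `hD2sup` VERBATIM at `𝔯 := resYOfC2 N θ M⋆ 𝔠` (the transfer weight `(Lʲη)⁻² = (Lʲη)^{+1}·(Lʲη)⁻³` by `scaleTransfer_len_rpow hF (−2)`, p. 398).
★★ `hD2L2_of_form_schemas` — plus def-Y's two displayed REALITY letters `hC hH` (`C⁽²⁾(U)`, `H(U)` commute with `⋆` at special-unitary `U`; the shapes of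
`Node00.lettersYOfRecordV4_symmDG₁GG_ofC2`) ⟹ edition 29's `hD2L2` VERBATIM at the same `𝔯` (`resYOfC2_Δ2_isSymmTr` + Schur `blockBd_d2coK_of_sup_symm`).
KNIT RECIPE (n06-d, editions ≥ 31, optional): at `𝔯 := resYOfC2 N θ M⋆ 𝔠` replace the binder `hD2L2` (resp. `hD2sup`) by `hC2 hHJ` (+ `hC hH`, already the inputs
of `hsymD` there) and `obtain ⟨ML₂, hD2L2⟩ := hD2L2_of_form_schemas q hq H 𝔠 𝔬12 bI hblk12 κC δC tHJ ρR δ₂ θ₂ M12 a12 …`; one more `max` in the threshold.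
HONEST FRAMING.  Kernel bookkeeping ((3.136) trace algebra, [4] (2.51)∕(2.54)∕(2.60)∕(2.61), Schur); COUNT-NEUTRAL; nothing of [B9]∕[5] asserted — [5]'s (149)
size of `C⁽²⁾` and print's `(H\*J)` line stay DISPLAYED letters about the genuine objects (the latter's derivation from (3.36) + (3.133) — r06
`B9Eq336CurrentBound.norm_J_le_blocks` + the rows-18∕19 H-letters — is the located next piece); the exponent `+1` of `hC2` is what (3.137)'s `−2` and the
printed `−3` force through (3.136), to be confirmed against [5] (136)∕(149) by the page owner when the letter is inhabited; N06 NOT discharged; K1⁷∕K1⁸ NOT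
closed.  One finite 𝕋⁴ programme at fixed `ε` — NOT continuum, NOT OS, NOT the mass gap ∕ Clay.  0 `def`, 0 `sorry`.
v1.1 (APPEND-ONLY, same seat∕day): `hD2sup_of_form_schemas_w` ∕ `hD2L2_of_form_schemas_w` — the two letters at FREE weight families `w_C`, `w_H` with
`w_C·w_H ≦ (Lʲη)⁻²` (the tree's `H† = trAdjY` differs from print's `H\*` by a volume factor; only the product of the weights is print's), v1.0 = the split (+1, −3).
-/

noncomputable section

namespace Summit.QuantumFields.YangMills.BalabanUVNodes.N06Delta2AtPinsC2Phys

open Literature.MathematicalPhysics.QuantumFieldTheory.Balaban1983to89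
open Literature.MathematicalPhysics.QuantumFieldTheory.Balaban1983to89.Node00 (CfgY FBondY IBondY GpY parSymY parBY trDualMatY trAdjY JY Stage3Params C2Y
  resYOfC2 resYOfC2_Δ2 resYOfC2_Δ2_isSymmTr)
open Literature.MathematicalPhysics.QuantumFieldTheory.Balaban1983to89.B9Eq3132SectDLetters (HDY)
open Literature.MathematicalPhysics.QuantumFieldTheory.Balaban1983to89.B9Thm34Ext (toB6)
open Literature.MathematicalPhysics.QuantumFieldTheory.Balaban1983to89.B11SectG (RowSum)
open Literature.MathematicalPhysics.QuantumFieldTheory.Balaban1983to89.B6RandomWalk (HasMajorant hasMajorant_mono)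
open Literature.MathematicalPhysics.QuantumFieldTheory.Balaban1983to89.B9SectDL2Decay (BlockBd)
open Literature.MathematicalPhysics.QuantumFieldTheory.Balaban1983to89.B9Thm312Whole (GeoOK)
open Literature.MathematicalPhysics.QuantumFieldTheory.Balaban1983to89.B9RWSums343to347Whole (Facts347)
open Literature.MathematicalPhysics.QuantumFieldTheory.Balaban1983to89.B9RWSumsDefinitePins (PinPrims)
open Literature.MathematicalPhysics.QuantumFieldTheory.Balaban1983to89.B9RWSums347DefiniteFaces (exp261 lemma21Pack_geo9Y)
open Literature.MathematicalPhysics.QuantumFieldTheory.Balaban1983to89.B9RowSum261DefiniteFaces (rowConst261 rowConst261_nonneg rowConst261_spec_of_rowSum261)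
open Literature.MathematicalPhysics.QuantumFieldTheory.Balaban1983to89.B9RWSums346Schur (scaleTransfer_len_rpow)
open Literature.MathematicalPhysics.QuantumFieldTheory.Balaban1983to89.B9PinMembersKLevelV1 (MemberY geo9Y bg9Y)
open Literature.MathematicalPhysics.QuantumFieldTheory.Balaban1983to89.B9PinGeometryKLevelV1 (c35Y)
open Literature.MathematicalPhysics.QuantumFieldTheory.Balaban1983to89.B9GeoLemma21KLevelV1 (geo9Y_len_pos geo9Y_dist_triangle geo9Y_dist_comm rowSum261_geo9Y)
open Literature.MathematicalPhysics.QuantumFieldTheory.Balaban1983to89.B9GeoNormsKLevelV1 (geo9K_dist_nonneg)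
open Literature.MathematicalPhysics.QuantumFieldTheory.Balaban1983to89.B7Prop2SpecialUnitary (specialUnitaryUnits specialUnitaryUnits_le_unitaryUnits)
open Literature.MathematicalPhysics.QuantumFieldTheory.Balaban1983to89.B9CoReadingCoords (XBK blkBK)
open Literature.MathematicalPhysics.QuantumFieldTheory.Balaban1983to89.B9CoReadingCoordsH (XHK)
open Literature.MathematicalPhysics.QuantumFieldTheory.Balaban1983to89.B9CoReadingCoordsS (XSK)
open Literature.MathematicalPhysics.QuantumFieldTheory.Balaban1983to89.B9CoReadingCoordsTranspose (TrIdx trBasis)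
open Literature.MathematicalPhysics.QuantumFieldTheory.Balaban1983to89.B9Thm39ReadingCoords (cR39 basisBound39)
open Literature.MathematicalPhysics.QuantumFieldTheory.Balaban1983to89.Node00.OpsYSectDCoords (cR39_trBasis_pos)
open Literature.MathematicalPhysics.QuantumFieldTheory.Balaban1983to89.B9PerturbationL2Delta2 (D2coK blockBd_d2coK_of_sup_symm)
open Literature.MathematicalPhysics.QuantumFieldTheory.Balaban1983to89.B9Delta2FormMajorant (C2FormMaj hasMajorant_coordOpK_delta2OfY)
open scoped Matrix.Norms.L2Operator

variable {N : ℕ} [NeZero N] {θ : Stage3Params} {Mstar : ℕ}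
variable [∀ x : MemberY θ.d₆ θ.ℓ₆ θ.hd' θ.hL' θ.b₀ θ.b₁ Mstar, Fintype (geo9Y x).Site]

/-- the kernel domination: `r·(…·(t·θ)·…)·W·e ≤ θ₂·θ·W·e` once `r·(…·t·…) ≤ θ₂` and `θ, W, e ≥ 0`. [cite: Balaban1985BackgroundPropagators, (3.137) p.423, bookkeeping] -/
private theorem kernel_dom {r n b κ t θ C c θ₂ W e : ℝ} (h : r * (n * b * κ * t * C * c) ≤ θ₂) (hθ : 0 ≤ θ) (hW : 0 ≤ W) (he : 0 ≤ e) :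
    r * (n * b * κ * (t * θ) * C * c) * W * e ≤ θ₂ * θ * W * e := by
  have h1 : r * (n * b * κ * (t * θ) * C * c) * W * e = (r * (n * b * κ * t * C * c)) * (θ * (W * e)) := by ring
  rw [h1, show θ₂ * θ * W * e = θ₂ * (θ * (W * e)) by ring]
  exact mul_le_mul_of_nonneg_right h (mul_nonneg hθ (mul_nonneg hW he))

/-- ★★ **EDITION 30's `hD2sup` — PRINT'S (3.137) SUP MAJORANT OF def-Y's GENUINE RESIDUAL `Δ⁽²⁾ = delta2OfY (𝔠 x).form` AT THE PINS — FROM TWO DISPLAYED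
LETTERS** (module docstring): for the residual family of record `𝔯 := resYOfC2 N θ M⋆ 𝔠` ([5]'s form letter `𝔠`), the certificate's pin `hblk12`, the primitive
constants `q` (member facts + (2.61) above ONE threshold), the letters `hC2` ([5] (149): `C2FormMaj` at the weight `(Lʲη)^{+1}`, rate `δ_C`) and `hHJ` (print
p. 422: `‖(H†J)(c)‖ ≦ t_{HJ}·Mα₀·(Lʲη)⁻³`) in the regime, and ONE displayed constant `θ₂ ≧ c⁻¹·2N·b²·κ_C·t_{HJ}·(ℓ+1)²·c_R`: above the threshold,
`HasMajorant (𝔬12 x).blk (D2coK … ((resYOfC2 N θ M⋆ 𝔠 x).Δ2) U) (θ₂·(M_xα₀)·(Lʲη)⁻²·e^{−δ₂ d})` for `δ₂ + α_F(1−2α)δ₀ + ρ_R ≦ δ_C`.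
[cite: Balaban1985BackgroundPropagators, (3.136)–(3.137) pp.422–423, (3.134) p.422, p.398; Balaban1985Averaging, (149) p.40; Balaban1984PropagatorsII, (2.51) p.232, (2.54), (2.60)–(2.61) pp.233–234] -/
theorem hD2sup_of_form_schemas (q : PinPrims) (hq : q.OK) (H : MemberY θ.d₆ θ.ℓ₆ θ.hd' θ.hL' θ.b₀ θ.b₁ Mstar → Prop) (𝔠 : C2Y N θ Mstar)
    (𝔬12 : ∀ x : MemberY θ.d₆ θ.ℓ₆ θ.hd' θ.hL' θ.b₀ θ.b₁ Mstar, B9Thm312Whole.Ops (geo9Y x) (bg9Y (Matrix (Fin N) (Fin N) ℂ) (specialUnitaryUnits (Fin N)) x)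
      (XBK (TrIdx N) x.toKIdx) (XBK (TrIdx N) x.toKIdx) (XHK (TrIdx N) x.toKIdx) (XSK (TrIdx N) x.toKIdx))
    (bI : ∀ x : MemberY θ.d₆ θ.ℓ₆ θ.hd' θ.hL' θ.b₀ θ.b₁ Mstar, FBondY x.toKIdx → IBondY x.toKIdx)
    (hblk12 : ∀ x : MemberY θ.d₆ θ.ℓ₆ θ.hd' θ.hL' θ.b₀ θ.b₁ Mstar, (𝔬12 x).blk = blkBK x.toKIdx (bI x))
    (κC δC tHJ ρR δ₂ θ₂ M a : ℝ) (hκC : 0 ≤ κC) (htHJ : 0 ≤ tHJ) (hρR : 0 < ρR) (hδ₂ : 0 ≤ δ₂) (hM : 0 < M)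
    (hδC : δ₂ + q.αF * ((1 - 2 * q.α) * q.δ₀) + ρR ≤ δC)
    (hθ₂ : (cR39 (trBasis N))⁻¹ * (2 * N * basisBound39 (trBasis N) ^ 2 * κC * tHJ * (((θ.ℓ₆ + 1 : ℕ) : ℝ) ^ 2) *
      rowConst261 (geo9Y (d := θ.d₆) (ℓ := θ.ℓ₆) (hd := θ.hd') (hL := θ.hL') (b₀ := θ.b₀) (b₁ := θ.b₁) (Mstar := Mstar)) ρR) ≤ θ₂)
    (hC2 : ∀ x : MemberY θ.d₆ θ.ℓ₆ θ.hd' θ.hL' θ.b₀ θ.b₁ Mstar, M ≤ (geo9Y x).M → ∀ α₀ : ℝ, 0 < α₀ → (geo9Y x).M * α₀ ≤ a →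
      ∀ U : (bg9Y (Matrix (Fin N) (Fin N) ℂ) (specialUnitaryUnits (Fin N)) x).Cfg,
        (bg9Y (Matrix (Fin N) (Fin N) ℂ) (specialUnitaryUnits (Fin N)) x).Reg335 c35Y α₀ U →
        (bg9Y (Matrix (Fin N) (Fin N) ℂ) (specialUnitaryUnits (Fin N)) x).Reg336 c35Y α₀ U →
          C2FormMaj x.toKIdx (g := geo9Y x) (bI x) (fun c => c) (𝔠 x).form U κC δC (fun c => (geo9Y x).len c))
    (hHJ : ∀ x : MemberY θ.d₆ θ.ℓ₆ θ.hd' θ.hL' θ.b₀ θ.b₁ Mstar, M ≤ (geo9Y x).M → ∀ α₀ : ℝ, 0 < α₀ → (geo9Y x).M * α₀ ≤ a →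
      ∀ U : (bg9Y (Matrix (Fin N) (Fin N) ℂ) (specialUnitaryUnits (Fin N)) x).Cfg,
        (bg9Y (Matrix (Fin N) (Fin N) ℂ) (specialUnitaryUnits (Fin N)) x).Reg335 c35Y α₀ U →
        (bg9Y (Matrix (Fin N) (Fin N) ℂ) (specialUnitaryUnits (Fin N)) x).Reg336 c35Y α₀ U →
          ∀ c : IBondY x.toKIdx,
            ‖trAdjY (trDualMatY N) (HDY x.toKIdx (parSymY x.toKIdx) (parBY x.toKIdx) (GpY x.toKIdx (parSymY x.toKIdx)) U) (JY x.toKIdx U) c‖ ≤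
              tHJ * ((geo9Y x).M * α₀) * ((geo9Y x).len c ^ 3)⁻¹) :
    ∃ ML : ℝ, ∀ x : MemberY θ.d₆ θ.ℓ₆ θ.hd' θ.hL' θ.b₀ θ.b₁ Mstar, ML ≤ (geo9Y x).M → M ≤ (geo9Y x).M → ∀ α₀ : ℝ, 0 < α₀ → (geo9Y x).M * α₀ ≤ a →
      ∀ U : (bg9Y (Matrix (Fin N) (Fin N) ℂ) (specialUnitaryUnits (Fin N)) x).Cfg,
        (bg9Y (Matrix (Fin N) (Fin N) ℂ) (specialUnitaryUnits (Fin N)) x).Reg335 c35Y α₀ U →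
        (bg9Y (Matrix (Fin N) (Fin N) ℂ) (specialUnitaryUnits (Fin N)) x).Reg336 c35Y α₀ U →
          HasMajorant (g := toB6 (geo9Y x) 1 (H x)) (𝔬12 x).blk
            (D2coK x.toKIdx (trBasis N) (bg9Y (Matrix (Fin N) (Fin N) ℂ) (specialUnitaryUnits (Fin N)) x) (fun U => U) ((resYOfC2 N θ Mstar 𝔠 x).Δ2) U)
            (fun (a b : (geo9Y x).Site) => θ₂ * ((geo9Y x).M * α₀) * ((geo9Y x).len a ^ 2)⁻¹ * Real.exp (-(δ₂ * (geo9Y x).dist a b))) := by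
  -- member facts at ((1 − 2α)δ₀, α_F) and [4] (2.61) at the rate ρ_R, above ONE threshold each
  obtain ⟨Mth, -, hfacts, -⟩ :=
    lemma21Pack_geo9Y (d := θ.d₆) (ℓ := θ.ℓ₆) (hd := θ.hd') (hL := θ.hL') (b₀ := θ.b₀) (b₁ := θ.b₁) (Mstar := Mstar) H hq.α_pos hq.α_lt
      hq.δ₀_pos hq.αF_pos (by linarith only [hq.αF_lt])
  obtain ⟨MLσ, hrowc⟩ := rowConst261_spec_of_rowSum261
    (rowSum261_geo9Y (d := θ.d₆) (ℓ := θ.ℓ₆) (hd := θ.hd') (hL := θ.hL') (b₀ := θ.b₀) (b₁ := θ.b₁) (Mstar := Mstar)) hρR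
  have hN : 0 < N := Nat.pos_of_ne_zero (NeZero.ne N)
  have hc0 : 0 < cR39 (trBasis N) := cR39_trBasis_pos hN
  have hτ : 0 ≤ q.αF * ((1 - 2 * q.α) * q.δ₀) :=
    mul_nonneg hq.αF_pos.le (mul_nonneg (by linarith only [hq.α_lt]) hq.δ₀_pos.le)
  refine ⟨max Mth MLσ, fun x hMx hMM α₀ hα ha U hU hU' => ?_⟩
  have hgeo : GeoOK (geo9Y x) := ⟨geo9Y_dist_triangle x, geo9Y_dist_comm x, geo9K_dist_nonneg x.toKIdx, geo9Y_len_pos x⟩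
  have hF := hfacts x ((le_max_left _ _).trans hMx)
  have hθ : 0 ≤ (geo9Y x).M * α₀ := mul_nonneg (hM.le.trans hMM) hα.le
  -- p. 398 transfer for the net weight (Lʲη)⁻² = (Lʲη)^{+1}·(Lʲη)⁻³
  have hL1 : 1 ≤ (geo9Y x).L := hF.one_le_L
  have hLle : (geo9Y x).L ^ |(-2 : ℝ)| ≤ ((θ.ℓ₆ + 1 : ℕ) : ℝ) ^ 2 := by
    rw [show |(-2 : ℝ)| = (2 : ℕ) by norm_num, Real.rpow_natCast]
    exact pow_le_pow_left₀ (zero_le_one.trans hL1) hF.L_le 2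
  have hT : ∀ (y : (geo9Y x).Site) (c : IBondY x.toKIdx),
      Real.exp (-(q.αF * ((1 - 2 * q.α) * q.δ₀) * (geo9Y x).dist y c)) * ((geo9Y x).len c * ((geo9Y x).len c ^ 3)⁻¹) ≤
        ((θ.ℓ₆ + 1 : ℕ) : ℝ) ^ 2 * ((geo9Y x).len y ^ 2)⁻¹ := by
    intro y c
    have hst := scaleTransfer_len_rpow hF (-2) (by norm_num) y c
    have hc := geo9Y_len_pos x c
    have hy := geo9Y_len_pos x y
    have e1 : (geo9Y x).len c * ((geo9Y x).len c ^ 3)⁻¹ = (geo9Y x).len c ^ (-2 : ℝ) := by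
      rw [show (-2 : ℝ) = -((2 : ℕ) : ℝ) by norm_num, Real.rpow_neg hc.le, Real.rpow_natCast]
      field_simp
    have e2 : ((geo9Y x).len y ^ 2)⁻¹ = (geo9Y x).len y ^ (-2 : ℝ) := by
      rw [show (-2 : ℝ) = -((2 : ℕ) : ℝ) by norm_num, Real.rpow_neg hy.le, Real.rpow_natCast]
    rw [e1, e2]
    exact hst.trans (mul_le_mul_of_nonneg_right hLle (Real.rpow_nonneg hy.le _))
  -- (2.61) at the rate ρ_R over the coarse bonds (= the geometry's sites)
  have hR : ∀ y : (geo9Y x).Site, ∑ c : IBondY x.toKIdx, Real.exp (-(ρR * (geo9Y x).dist y c)) ≤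
      rowConst261 (geo9Y (d := θ.d₆) (ℓ := θ.ℓ₆) (hd := θ.hd') (hL := θ.hL') (b₀ := θ.b₀) (b₁ := θ.b₁) (Mstar := Mstar)) ρR := by
    intro y
    have h := hrowc x ((le_max_right _ _).trans hMx) y
    have huniv : (Finset.univ : Finset (IBondY x.toKIdx)) =
        @Finset.univ (geo9Y x).Site (‹∀ x : MemberY θ.d₆ θ.ℓ₆ θ.hd' θ.hL' θ.b₀ θ.b₁ Mstar, Fintype (geo9Y x).Site› x) := by
      ext c
      exact ⟨fun _ => @Finset.mem_univ (geo9Y x).Site (‹∀ x : MemberY θ.d₆ θ.ℓ₆ θ.hd' θ.hL' θ.b₀ θ.b₁ Mstar, Fintype (geo9Y x).Site› x) c,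
        fun _ => Finset.mem_univ c⟩
    rw [huniv]; exact h
  -- the generic majorant at this member's letters
  have hmain := hasMajorant_coordOpK_delta2OfY x.toKIdx (parSymY x.toKIdx) (parBY x.toKIdx) (GpY x.toKIdx (parSymY x.toKIdx)) (𝔠 x).form
    (g := geo9Y x) (R₀ := 1) (H₀ := H x) hgeo (bI x) (fun c => c) U
    (κC := κC) (δC := δC) (tHJ := tHJ * ((geo9Y x).M * α₀)) (ρT := q.αF * ((1 - 2 * q.α) * q.δ₀)) (CT := ((θ.ℓ₆ + 1 : ℕ) : ℝ) ^ 2)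
    (ρR := ρR) (cR := rowConst261 (geo9Y (d := θ.d₆) (ℓ := θ.ℓ₆) (hd := θ.hd') (hL := θ.hL') (b₀ := θ.b₀) (b₁ := θ.b₁) (Mstar := Mstar)) ρR)
    (δ₂ := δ₂) (r := (cR39 (trBasis N))⁻¹)
    (wC := fun c => (geo9Y x).len c) (wH := fun c => ((geo9Y x).len c ^ 3)⁻¹) (W := fun y => ((geo9Y x).len y ^ 2)⁻¹)
    hκC (fun y => (geo9Y_len_pos x y).le) (mul_nonneg htHJ hθ) (fun y => inv_nonneg.mpr (pow_nonneg (geo9Y_len_pos x y).le 3)) (by positivity)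
    (fun y => inv_nonneg.mpr (pow_nonneg (geo9Y_len_pos x y).le 2)) (inv_nonneg.mpr hc0.le) hδ₂ hτ hρR.le hδC
    (hC2 x hMM α₀ hα ha U hU hU') (hHJ x hMM α₀ hα ha U hU hU') hT hR
  rw [hblk12 x]
  refine hasMajorant_mono _ hmain fun y y' => ?_
  exact kernel_dom hθ₂ hθ (inv_nonneg.mpr (pow_nonneg (geo9Y_len_pos x y).le 2)) (Real.exp_nonneg _)

/-- ★★ **EDITION 29's `hD2L2` — (3.137) IN BLOCK-L² FOR def-Y's GENUINE RESIDUAL AT THE PINS — FROM THE SAME TWO LETTERS PLUS THE REALITY OF `𝔠`, `H`**: the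
inputs of `hD2sup_of_form_schemas` and def-Y's two displayed reality letters (`hC` : `C⁽²⁾(U)` commutes with `⋆`; `hH` : `H(U)` commutes with `⋆`, at special-unitary
`U`) give, above the same threshold, `BlockBd (𝔬12 x).blk (𝔬12 x).blk (D2coK … ((resYOfC2 N θ M⋆ 𝔠 x).Δ2) U) (θ₂·(M_xα₀)·(Lʲη)⁻¹·(L^{j′}η)⁻¹·e^{−δ₂ d})` — edition 29's
displayed `hD2L2` at `𝔯 := resYOfC2 N θ M⋆ 𝔠`: the sup majorant (`hD2sup_of_form_schemas`) + `Δ⁽²⁾(U)` trace-symmetric (def-Y `resYOfC2_Δ2_isSymmTr`) + Schur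
(n06-w8 g0 `blockBd_d2coK_of_sup_symm`). [cite: Balaban1985BackgroundPropagators, (3.137) p.423, (3.134) p.422, (3.46) p.398, p.391; Balaban1985Averaging, (149) p.40; Balaban1984PropagatorsII, (2.51) p.232] -/
theorem hD2L2_of_form_schemas (q : PinPrims) (hq : q.OK) (H : MemberY θ.d₆ θ.ℓ₆ θ.hd' θ.hL' θ.b₀ θ.b₁ Mstar → Prop) (𝔠 : C2Y N θ Mstar)
    (𝔬12 : ∀ x : MemberY θ.d₆ θ.ℓ₆ θ.hd' θ.hL' θ.b₀ θ.b₁ Mstar, B9Thm312Whole.Ops (geo9Y x) (bg9Y (Matrix (Fin N) (Fin N) ℂ) (specialUnitaryUnits (Fin N)) x)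
      (XBK (TrIdx N) x.toKIdx) (XBK (TrIdx N) x.toKIdx) (XHK (TrIdx N) x.toKIdx) (XSK (TrIdx N) x.toKIdx))
    (bI : ∀ x : MemberY θ.d₆ θ.ℓ₆ θ.hd' θ.hL' θ.b₀ θ.b₁ Mstar, FBondY x.toKIdx → IBondY x.toKIdx)
    (hblk12 : ∀ x : MemberY θ.d₆ θ.ℓ₆ θ.hd' θ.hL' θ.b₀ θ.b₁ Mstar, (𝔬12 x).blk = blkBK x.toKIdx (bI x))
    (κC δC tHJ ρR δ₂ θ₂ M a : ℝ) (hκC : 0 ≤ κC) (htHJ : 0 ≤ tHJ) (hρR : 0 < ρR) (hδ₂ : 0 ≤ δ₂) (hθ₂0 : 0 ≤ θ₂) (hM : 0 < M)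
    (hδC : δ₂ + q.αF * ((1 - 2 * q.α) * q.δ₀) + ρR ≤ δC)
    (hθ₂ : (cR39 (trBasis N))⁻¹ * (2 * N * basisBound39 (trBasis N) ^ 2 * κC * tHJ * (((θ.ℓ₆ + 1 : ℕ) : ℝ) ^ 2) *
      rowConst261 (geo9Y (d := θ.d₆) (ℓ := θ.ℓ₆) (hd := θ.hd') (hL := θ.hL') (b₀ := θ.b₀) (b₁ := θ.b₁) (Mstar := Mstar)) ρR) ≤ θ₂)
    (hC2 : ∀ x : MemberY θ.d₆ θ.ℓ₆ θ.hd' θ.hL' θ.b₀ θ.b₁ Mstar, M ≤ (geo9Y x).M → ∀ α₀ : ℝ, 0 < α₀ → (geo9Y x).M * α₀ ≤ a →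
      ∀ U : (bg9Y (Matrix (Fin N) (Fin N) ℂ) (specialUnitaryUnits (Fin N)) x).Cfg,
        (bg9Y (Matrix (Fin N) (Fin N) ℂ) (specialUnitaryUnits (Fin N)) x).Reg335 c35Y α₀ U →
        (bg9Y (Matrix (Fin N) (Fin N) ℂ) (specialUnitaryUnits (Fin N)) x).Reg336 c35Y α₀ U →
          C2FormMaj x.toKIdx (g := geo9Y x) (bI x) (fun c => c) (𝔠 x).form U κC δC (fun c => (geo9Y x).len c))
    (hHJ : ∀ x : MemberY θ.d₆ θ.ℓ₆ θ.hd' θ.hL' θ.b₀ θ.b₁ Mstar, M ≤ (geo9Y x).M → ∀ α₀ : ℝ, 0 < α₀ → (geo9Y x).M * α₀ ≤ a →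
      ∀ U : (bg9Y (Matrix (Fin N) (Fin N) ℂ) (specialUnitaryUnits (Fin N)) x).Cfg,
        (bg9Y (Matrix (Fin N) (Fin N) ℂ) (specialUnitaryUnits (Fin N)) x).Reg335 c35Y α₀ U →
        (bg9Y (Matrix (Fin N) (Fin N) ℂ) (specialUnitaryUnits (Fin N)) x).Reg336 c35Y α₀ U →
          ∀ c : IBondY x.toKIdx,
            ‖trAdjY (trDualMatY N) (HDY x.toKIdx (parSymY x.toKIdx) (parBY x.toKIdx) (GpY x.toKIdx (parSymY x.toKIdx)) U) (JY x.toKIdx U) c‖ ≤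
              tHJ * ((geo9Y x).M * α₀) * ((geo9Y x).len c ^ 3)⁻¹)
    (hC : ∀ (x : MemberY θ.d₆ θ.ℓ₆ θ.hd' θ.hL' θ.b₀ θ.b₁ Mstar) (U : CfgY (Matrix (Fin N) (Fin N) ℂ) x.toKIdx), (∀ μ z, U μ z ∈ specialUnitaryUnits (Fin N)) →
      ∀ A A' : FBondY x.toKIdx → Matrix (Fin N) (Fin N) ℂ, (𝔠 x).form U (star A) (star A') = star ((𝔠 x).form U A A'))
    (hH : ∀ (x : MemberY θ.d₆ θ.ℓ₆ θ.hd' θ.hL' θ.b₀ θ.b₁ Mstar) (U : CfgY (Matrix (Fin N) (Fin N) ℂ) x.toKIdx), (∀ μ z, U μ z ∈ specialUnitaryUnits (Fin N)) →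
      ∀ X : IBondY x.toKIdx → Matrix (Fin N) (Fin N) ℂ,
        HDY x.toKIdx (parSymY x.toKIdx) (parBY x.toKIdx) (GpY x.toKIdx (parSymY x.toKIdx)) U (star X) =
          star (HDY x.toKIdx (parSymY x.toKIdx) (parBY x.toKIdx) (GpY x.toKIdx (parSymY x.toKIdx)) U X)) :
    ∃ ML : ℝ, ∀ x : MemberY θ.d₆ θ.ℓ₆ θ.hd' θ.hL' θ.b₀ θ.b₁ Mstar, ML ≤ (geo9Y x).M → M ≤ (geo9Y x).M → ∀ α₀ : ℝ, 0 < α₀ → (geo9Y x).M * α₀ ≤ a →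
      ∀ U : (bg9Y (Matrix (Fin N) (Fin N) ℂ) (specialUnitaryUnits (Fin N)) x).Cfg,
        (bg9Y (Matrix (Fin N) (Fin N) ℂ) (specialUnitaryUnits (Fin N)) x).Reg335 c35Y α₀ U →
        (bg9Y (Matrix (Fin N) (Fin N) ℂ) (specialUnitaryUnits (Fin N)) x).Reg336 c35Y α₀ U →
          BlockBd (g := toB6 (geo9Y x) 1 (H x)) (𝔬12 x).blk (𝔬12 x).blk
            (D2coK x.toKIdx (trBasis N) (bg9Y (Matrix (Fin N) (Fin N) ℂ) (specialUnitaryUnits (Fin N)) x) (fun U => U) ((resYOfC2 N θ Mstar 𝔠 x).Δ2) U)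
            (fun (y y' : (geo9Y x).Site) => θ₂ * ((geo9Y x).M * α₀) * ((geo9Y x).len y)⁻¹ * ((geo9Y x).len y')⁻¹ *
              Real.exp (-(δ₂ * (geo9Y x).dist y y'))) := by
  obtain ⟨ML, hsup⟩ := hD2sup_of_form_schemas q hq H 𝔠 𝔬12 bI hblk12 κC δC tHJ ρR δ₂ θ₂ M a hκC htHJ hρR hδ₂ hM hδC hθ₂ hC2 hHJ
  refine ⟨ML, fun x hMx hMM α₀ hα ha U hU hU' => ?_⟩
  have hgeo : GeoOK (geo9Y x) := ⟨geo9Y_dist_triangle x, geo9Y_dist_comm x, geo9K_dist_nonneg x.toKIdx, geo9Y_len_pos x⟩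
  have hθ : 0 ≤ θ₂ * ((geo9Y x).M * α₀) := mul_nonneg hθ₂0 (mul_nonneg (hM.le.trans hMM) hα.le)
  have hΔ := resYOfC2_Δ2_isSymmTr θ Mstar 𝔠 x (U := U) (fun μ z => specialUnitaryUnits_le_unitaryUnits (hU.1.1 μ z)) (hC x U hU.1.1) (hH x U hU.1.1)
  have h := hsup x hMx hMM α₀ hα ha U hU hU'
  rw [hblk12 x] at h ⊢
  exact blockBd_d2coK_of_sup_symm x.toKIdx (bg9Y (Matrix (Fin N) (Fin N) ℂ) (specialUnitaryUnits (Fin N)) x) (fun U => U)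
    ((resYOfC2 N θ Mstar 𝔠 x).Δ2) (R₀ := 1) (H₀ := H x) hgeo hθ h hΔ

/-! ## v1.1 (APPEND-ONLY) — the same two binders for ANY SPLIT OF THE NET WEIGHT `(Lʲη)⁻²` between the two letters

Print's two sentences fix the PRODUCT of the letters' scale weights through (3.136) — `(Lʲη)⁻²` of (3.137) — but the tree's normalisation of def-Y's trace transpose
`H† = trAdjY` (unweighted sums on both lattices) differs from print's `H\*` (weights `η^d` ∕ `(Lʲη)^{d+1}`, (3.11) ∕ (3.136)) by a volume factor, and [5]'s (149) reads the
test delta through a block AVERAGE; so the honest pinned form leaves the two weights `w_C`, `w_H` FREE, subject only to `w_C(c)·w_H(c) ≦ (Lʲη)⁻²` (and signs).  The v1.0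
theorems are the case `w_C = (Lʲη)^{+1}`, `w_H = (Lʲη)⁻³`. -/

/-- ★★ **`hD2sup` FOR ANY WEIGHT SPLIT**: as `hD2sup_of_form_schemas`, with the form letter at a free weight family `w_C` and the current letter at a free weight family
`w_H`, `0 ≦ w_C, w_H`, `w_C(c)·w_H(c) ≦ ((Lʲη)_c²)⁻¹` — conclusion unchanged (edition 30's `hD2sup` at `𝔯 := resYOfC2 N θ M⋆ 𝔠`).
[cite: Balaban1985BackgroundPropagators, (3.136)–(3.137) pp.422–423, (3.11) p.392, p.398; Balaban1985Averaging, (149) p.40; Balaban1984PropagatorsII, (2.51) p.232, (2.54), (2.60)–(2.61) pp.233–234] -/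
theorem hD2sup_of_form_schemas_w (q : PinPrims) (hq : q.OK) (H : MemberY θ.d₆ θ.ℓ₆ θ.hd' θ.hL' θ.b₀ θ.b₁ Mstar → Prop) (𝔠 : C2Y N θ Mstar)
    (𝔬12 : ∀ x : MemberY θ.d₆ θ.ℓ₆ θ.hd' θ.hL' θ.b₀ θ.b₁ Mstar, B9Thm312Whole.Ops (geo9Y x) (bg9Y (Matrix (Fin N) (Fin N) ℂ) (specialUnitaryUnits (Fin N)) x)
      (XBK (TrIdx N) x.toKIdx) (XBK (TrIdx N) x.toKIdx) (XHK (TrIdx N) x.toKIdx) (XSK (TrIdx N) x.toKIdx))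
    (bI : ∀ x : MemberY θ.d₆ θ.ℓ₆ θ.hd' θ.hL' θ.b₀ θ.b₁ Mstar, FBondY x.toKIdx → IBondY x.toKIdx)
    (hblk12 : ∀ x : MemberY θ.d₆ θ.ℓ₆ θ.hd' θ.hL' θ.b₀ θ.b₁ Mstar, (𝔬12 x).blk = blkBK x.toKIdx (bI x))
    (wC wH : ∀ x : MemberY θ.d₆ θ.ℓ₆ θ.hd' θ.hL' θ.b₀ θ.b₁ Mstar, IBondY x.toKIdx → ℝ)
    (hwC : ∀ x c, 0 ≤ wC x c) (hwH : ∀ x c, 0 ≤ wH x c) (hww : ∀ x c, wC x c * wH x c ≤ ((geo9Y x).len c ^ 2)⁻¹)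
    (κC δC tHJ ρR δ₂ θ₂ M a : ℝ) (hκC : 0 ≤ κC) (htHJ : 0 ≤ tHJ) (hρR : 0 < ρR) (hδ₂ : 0 ≤ δ₂) (hM : 0 < M)
    (hδC : δ₂ + q.αF * ((1 - 2 * q.α) * q.δ₀) + ρR ≤ δC)
    (hθ₂ : (cR39 (trBasis N))⁻¹ * (2 * N * basisBound39 (trBasis N) ^ 2 * κC * tHJ * (((θ.ℓ₆ + 1 : ℕ) : ℝ) ^ 2) *
      rowConst261 (geo9Y (d := θ.d₆) (ℓ := θ.ℓ₆) (hd := θ.hd') (hL := θ.hL') (b₀ := θ.b₀) (b₁ := θ.b₁) (Mstar := Mstar)) ρR) ≤ θ₂)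
    (hC2 : ∀ x : MemberY θ.d₆ θ.ℓ₆ θ.hd' θ.hL' θ.b₀ θ.b₁ Mstar, M ≤ (geo9Y x).M → ∀ α₀ : ℝ, 0 < α₀ → (geo9Y x).M * α₀ ≤ a →
      ∀ U : (bg9Y (Matrix (Fin N) (Fin N) ℂ) (specialUnitaryUnits (Fin N)) x).Cfg,
        (bg9Y (Matrix (Fin N) (Fin N) ℂ) (specialUnitaryUnits (Fin N)) x).Reg335 c35Y α₀ U →
        (bg9Y (Matrix (Fin N) (Fin N) ℂ) (specialUnitaryUnits (Fin N)) x).Reg336 c35Y α₀ U →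
          C2FormMaj x.toKIdx (g := geo9Y x) (bI x) (fun c => c) (𝔠 x).form U κC δC (wC x))
    (hHJ : ∀ x : MemberY θ.d₆ θ.ℓ₆ θ.hd' θ.hL' θ.b₀ θ.b₁ Mstar, M ≤ (geo9Y x).M → ∀ α₀ : ℝ, 0 < α₀ → (geo9Y x).M * α₀ ≤ a →
      ∀ U : (bg9Y (Matrix (Fin N) (Fin N) ℂ) (specialUnitaryUnits (Fin N)) x).Cfg,
        (bg9Y (Matrix (Fin N) (Fin N) ℂ) (specialUnitaryUnits (Fin N)) x).Reg335 c35Y α₀ U →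
        (bg9Y (Matrix (Fin N) (Fin N) ℂ) (specialUnitaryUnits (Fin N)) x).Reg336 c35Y α₀ U →
          ∀ c : IBondY x.toKIdx,
            ‖trAdjY (trDualMatY N) (HDY x.toKIdx (parSymY x.toKIdx) (parBY x.toKIdx) (GpY x.toKIdx (parSymY x.toKIdx)) U) (JY x.toKIdx U) c‖ ≤
              tHJ * ((geo9Y x).M * α₀) * wH x c) :
    ∃ ML : ℝ, ∀ x : MemberY θ.d₆ θ.ℓ₆ θ.hd' θ.hL' θ.b₀ θ.b₁ Mstar, ML ≤ (geo9Y x).M → M ≤ (geo9Y x).M → ∀ α₀ : ℝ, 0 < α₀ → (geo9Y x).M * α₀ ≤ a →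
      ∀ U : (bg9Y (Matrix (Fin N) (Fin N) ℂ) (specialUnitaryUnits (Fin N)) x).Cfg,
        (bg9Y (Matrix (Fin N) (Fin N) ℂ) (specialUnitaryUnits (Fin N)) x).Reg335 c35Y α₀ U →
        (bg9Y (Matrix (Fin N) (Fin N) ℂ) (specialUnitaryUnits (Fin N)) x).Reg336 c35Y α₀ U →
          HasMajorant (g := toB6 (geo9Y x) 1 (H x)) (𝔬12 x).blk
            (D2coK x.toKIdx (trBasis N) (bg9Y (Matrix (Fin N) (Fin N) ℂ) (specialUnitaryUnits (Fin N)) x) (fun U => U) ((resYOfC2 N θ Mstar 𝔠 x).Δ2) U)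
            (fun (a b : (geo9Y x).Site) => θ₂ * ((geo9Y x).M * α₀) * ((geo9Y x).len a ^ 2)⁻¹ * Real.exp (-(δ₂ * (geo9Y x).dist a b))) := by
  obtain ⟨Mth, -, hfacts, -⟩ :=
    lemma21Pack_geo9Y (d := θ.d₆) (ℓ := θ.ℓ₆) (hd := θ.hd') (hL := θ.hL') (b₀ := θ.b₀) (b₁ := θ.b₁) (Mstar := Mstar) H hq.α_pos hq.α_lt
      hq.δ₀_pos hq.αF_pos (by linarith only [hq.αF_lt])
  obtain ⟨MLσ, hrowc⟩ := rowConst261_spec_of_rowSum261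
    (rowSum261_geo9Y (d := θ.d₆) (ℓ := θ.ℓ₆) (hd := θ.hd') (hL := θ.hL') (b₀ := θ.b₀) (b₁ := θ.b₁) (Mstar := Mstar)) hρR
  have hN : 0 < N := Nat.pos_of_ne_zero (NeZero.ne N)
  have hc0 : 0 < cR39 (trBasis N) := cR39_trBasis_pos hN
  have hτ : 0 ≤ q.αF * ((1 - 2 * q.α) * q.δ₀) :=
    mul_nonneg hq.αF_pos.le (mul_nonneg (by linarith only [hq.α_lt]) hq.δ₀_pos.le)
  refine ⟨max Mth MLσ, fun x hMx hMM α₀ hα ha U hU hU' => ?_⟩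
  have hgeo : GeoOK (geo9Y x) := ⟨geo9Y_dist_triangle x, geo9Y_dist_comm x, geo9K_dist_nonneg x.toKIdx, geo9Y_len_pos x⟩
  have hF := hfacts x ((le_max_left _ _).trans hMx)
  have hθ : 0 ≤ (geo9Y x).M * α₀ := mul_nonneg (hM.le.trans hMM) hα.le
  -- p. 398 transfer for the net weight (Lʲη)⁻² ≥ w_C·w_H
  have hL1 : 1 ≤ (geo9Y x).L := hF.one_le_L
  have hLle : (geo9Y x).L ^ |(-2 : ℝ)| ≤ ((θ.ℓ₆ + 1 : ℕ) : ℝ) ^ 2 := by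
    rw [show |(-2 : ℝ)| = (2 : ℕ) by norm_num, Real.rpow_natCast]
    exact pow_le_pow_left₀ (zero_le_one.trans hL1) hF.L_le 2
  have hT : ∀ (y : (geo9Y x).Site) (c : IBondY x.toKIdx),
      Real.exp (-(q.αF * ((1 - 2 * q.α) * q.δ₀) * (geo9Y x).dist y c)) * (wC x c * wH x c) ≤
        ((θ.ℓ₆ + 1 : ℕ) : ℝ) ^ 2 * ((geo9Y x).len y ^ 2)⁻¹ := by
    intro y c
    have hst := scaleTransfer_len_rpow hF (-2) (by norm_num) y c
    have hc := geo9Y_len_pos x c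
    have hy := geo9Y_len_pos x y
    have e1 : ((geo9Y x).len c ^ 2)⁻¹ = (geo9Y x).len c ^ (-2 : ℝ) := by
      rw [show (-2 : ℝ) = -((2 : ℕ) : ℝ) by norm_num, Real.rpow_neg hc.le, Real.rpow_natCast]
    have e2 : ((geo9Y x).len y ^ 2)⁻¹ = (geo9Y x).len y ^ (-2 : ℝ) := by
      rw [show (-2 : ℝ) = -((2 : ℕ) : ℝ) by norm_num, Real.rpow_neg hy.le, Real.rpow_natCast]
    calc Real.exp (-(q.αF * ((1 - 2 * q.α) * q.δ₀) * (geo9Y x).dist y c)) * (wC x c * wH x c)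
        ≤ Real.exp (-(q.αF * ((1 - 2 * q.α) * q.δ₀) * (geo9Y x).dist y c)) * (geo9Y x).len c ^ (-2 : ℝ) := by
          rw [← e1]; exact mul_le_mul_of_nonneg_left (hww x c) (Real.exp_nonneg _)
      _ ≤ ((θ.ℓ₆ + 1 : ℕ) : ℝ) ^ 2 * ((geo9Y x).len y ^ 2)⁻¹ := by
          rw [e2]; exact hst.trans (mul_le_mul_of_nonneg_right hLle (Real.rpow_nonneg hy.le _))
  have hR : ∀ y : (geo9Y x).Site, ∑ c : IBondY x.toKIdx, Real.exp (-(ρR * (geo9Y x).dist y c)) ≤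
      rowConst261 (geo9Y (d := θ.d₆) (ℓ := θ.ℓ₆) (hd := θ.hd') (hL := θ.hL') (b₀ := θ.b₀) (b₁ := θ.b₁) (Mstar := Mstar)) ρR := by
    intro y
    have h := hrowc x ((le_max_right _ _).trans hMx) y
    have huniv : (Finset.univ : Finset (IBondY x.toKIdx)) =
        @Finset.univ (geo9Y x).Site (‹∀ x : MemberY θ.d₆ θ.ℓ₆ θ.hd' θ.hL' θ.b₀ θ.b₁ Mstar, Fintype (geo9Y x).Site› x) := by
      ext c
      exact ⟨fun _ => @Finset.mem_univ (geo9Y x).Site (‹∀ x : MemberY θ.d₆ θ.ℓ₆ θ.hd' θ.hL' θ.b₀ θ.b₁ Mstar, Fintype (geo9Y x).Site› x) c,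
        fun _ => Finset.mem_univ c⟩
    rw [huniv]; exact h
  have hmain := hasMajorant_coordOpK_delta2OfY x.toKIdx (parSymY x.toKIdx) (parBY x.toKIdx) (GpY x.toKIdx (parSymY x.toKIdx)) (𝔠 x).form
    (g := geo9Y x) (R₀ := 1) (H₀ := H x) hgeo (bI x) (fun c => c) U
    (κC := κC) (δC := δC) (tHJ := tHJ * ((geo9Y x).M * α₀)) (ρT := q.αF * ((1 - 2 * q.α) * q.δ₀)) (CT := ((θ.ℓ₆ + 1 : ℕ) : ℝ) ^ 2)
    (ρR := ρR) (cR := rowConst261 (geo9Y (d := θ.d₆) (ℓ := θ.ℓ₆) (hd := θ.hd') (hL := θ.hL') (b₀ := θ.b₀) (b₁ := θ.b₁) (Mstar := Mstar)) ρR)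
    (δ₂ := δ₂) (r := (cR39 (trBasis N))⁻¹) (wC := wC x) (wH := wH x) (W := fun y => ((geo9Y x).len y ^ 2)⁻¹)
    hκC (hwC x) (mul_nonneg htHJ hθ) (hwH x) (by positivity)
    (fun y => inv_nonneg.mpr (pow_nonneg (geo9Y_len_pos x y).le 2)) (inv_nonneg.mpr hc0.le) hδ₂ hτ hρR.le hδC
    (hC2 x hMM α₀ hα ha U hU hU') (hHJ x hMM α₀ hα ha U hU hU') hT hR
  rw [hblk12 x]
  refine hasMajorant_mono _ hmain fun y y' => ?_
  exact kernel_dom hθ₂ hθ (inv_nonneg.mpr (pow_nonneg (geo9Y_len_pos x y).le 2)) (Real.exp_nonneg _)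

/-- ★★ **`hD2L2` FOR ANY WEIGHT SPLIT**: `hD2sup_of_form_schemas_w` + def-Y's reality letters ⟹ edition 29's `hD2L2` at `𝔯 := resYOfC2 N θ M⋆ 𝔠`.
[cite: Balaban1985BackgroundPropagators, (3.137) p.423, (3.134) p.422, (3.46) p.398, p.391; Balaban1985Averaging, (149) p.40; Balaban1984PropagatorsII, (2.51) p.232] -/
theorem hD2L2_of_form_schemas_w (q : PinPrims) (hq : q.OK) (H : MemberY θ.d₆ θ.ℓ₆ θ.hd' θ.hL' θ.b₀ θ.b₁ Mstar → Prop) (𝔠 : C2Y N θ Mstar)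
    (𝔬12 : ∀ x : MemberY θ.d₆ θ.ℓ₆ θ.hd' θ.hL' θ.b₀ θ.b₁ Mstar, B9Thm312Whole.Ops (geo9Y x) (bg9Y (Matrix (Fin N) (Fin N) ℂ) (specialUnitaryUnits (Fin N)) x)
      (XBK (TrIdx N) x.toKIdx) (XBK (TrIdx N) x.toKIdx) (XHK (TrIdx N) x.toKIdx) (XSK (TrIdx N) x.toKIdx))
    (bI : ∀ x : MemberY θ.d₆ θ.ℓ₆ θ.hd' θ.hL' θ.b₀ θ.b₁ Mstar, FBondY x.toKIdx → IBondY x.toKIdx)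
    (hblk12 : ∀ x : MemberY θ.d₆ θ.ℓ₆ θ.hd' θ.hL' θ.b₀ θ.b₁ Mstar, (𝔬12 x).blk = blkBK x.toKIdx (bI x))
    (wC wH : ∀ x : MemberY θ.d₆ θ.ℓ₆ θ.hd' θ.hL' θ.b₀ θ.b₁ Mstar, IBondY x.toKIdx → ℝ)
    (hwC : ∀ x c, 0 ≤ wC x c) (hwH : ∀ x c, 0 ≤ wH x c) (hww : ∀ x c, wC x c * wH x c ≤ ((geo9Y x).len c ^ 2)⁻¹)
    (κC δC tHJ ρR δ₂ θ₂ M a : ℝ) (hκC : 0 ≤ κC) (htHJ : 0 ≤ tHJ) (hρR : 0 < ρR) (hδ₂ : 0 ≤ δ₂) (hθ₂0 : 0 ≤ θ₂) (hM : 0 < M)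
    (hδC : δ₂ + q.αF * ((1 - 2 * q.α) * q.δ₀) + ρR ≤ δC)
    (hθ₂ : (cR39 (trBasis N))⁻¹ * (2 * N * basisBound39 (trBasis N) ^ 2 * κC * tHJ * (((θ.ℓ₆ + 1 : ℕ) : ℝ) ^ 2) *
      rowConst261 (geo9Y (d := θ.d₆) (ℓ := θ.ℓ₆) (hd := θ.hd') (hL := θ.hL') (b₀ := θ.b₀) (b₁ := θ.b₁) (Mstar := Mstar)) ρR) ≤ θ₂)
    (hC2 : ∀ x : MemberY θ.d₆ θ.ℓ₆ θ.hd' θ.hL' θ.b₀ θ.b₁ Mstar, M ≤ (geo9Y x).M → ∀ α₀ : ℝ, 0 < α₀ → (geo9Y x).M * α₀ ≤ a →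
      ∀ U : (bg9Y (Matrix (Fin N) (Fin N) ℂ) (specialUnitaryUnits (Fin N)) x).Cfg,
        (bg9Y (Matrix (Fin N) (Fin N) ℂ) (specialUnitaryUnits (Fin N)) x).Reg335 c35Y α₀ U →
        (bg9Y (Matrix (Fin N) (Fin N) ℂ) (specialUnitaryUnits (Fin N)) x).Reg336 c35Y α₀ U →
          C2FormMaj x.toKIdx (g := geo9Y x) (bI x) (fun c => c) (𝔠 x).form U κC δC (wC x))
    (hHJ : ∀ x : MemberY θ.d₆ θ.ℓ₆ θ.hd' θ.hL' θ.b₀ θ.b₁ Mstar, M ≤ (geo9Y x).M → ∀ α₀ : ℝ, 0 < α₀ → (geo9Y x).M * α₀ ≤ a →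
      ∀ U : (bg9Y (Matrix (Fin N) (Fin N) ℂ) (specialUnitaryUnits (Fin N)) x).Cfg,
        (bg9Y (Matrix (Fin N) (Fin N) ℂ) (specialUnitaryUnits (Fin N)) x).Reg335 c35Y α₀ U →
        (bg9Y (Matrix (Fin N) (Fin N) ℂ) (specialUnitaryUnits (Fin N)) x).Reg336 c35Y α₀ U →
          ∀ c : IBondY x.toKIdx,
            ‖trAdjY (trDualMatY N) (HDY x.toKIdx (parSymY x.toKIdx) (parBY x.toKIdx) (GpY x.toKIdx (parSymY x.toKIdx)) U) (JY x.toKIdx U) c‖ ≤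
              tHJ * ((geo9Y x).M * α₀) * wH x c)
    (hC : ∀ (x : MemberY θ.d₆ θ.ℓ₆ θ.hd' θ.hL' θ.b₀ θ.b₁ Mstar) (U : CfgY (Matrix (Fin N) (Fin N) ℂ) x.toKIdx), (∀ μ z, U μ z ∈ specialUnitaryUnits (Fin N)) →
      ∀ A A' : FBondY x.toKIdx → Matrix (Fin N) (Fin N) ℂ, (𝔠 x).form U (star A) (star A') = star ((𝔠 x).form U A A'))
    (hH : ∀ (x : MemberY θ.d₆ θ.ℓ₆ θ.hd' θ.hL' θ.b₀ θ.b₁ Mstar) (U : CfgY (Matrix (Fin N) (Fin N) ℂ) x.toKIdx), (∀ μ z, U μ z ∈ specialUnitaryUnits (Fin N)) →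
      ∀ X : IBondY x.toKIdx → Matrix (Fin N) (Fin N) ℂ,
        HDY x.toKIdx (parSymY x.toKIdx) (parBY x.toKIdx) (GpY x.toKIdx (parSymY x.toKIdx)) U (star X) =
          star (HDY x.toKIdx (parSymY x.toKIdx) (parBY x.toKIdx) (GpY x.toKIdx (parSymY x.toKIdx)) U X)) :
    ∃ ML : ℝ, ∀ x : MemberY θ.d₆ θ.ℓ₆ θ.hd' θ.hL' θ.b₀ θ.b₁ Mstar, ML ≤ (geo9Y x).M → M ≤ (geo9Y x).M → ∀ α₀ : ℝ, 0 < α₀ → (geo9Y x).M * α₀ ≤ a →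
      ∀ U : (bg9Y (Matrix (Fin N) (Fin N) ℂ) (specialUnitaryUnits (Fin N)) x).Cfg,
        (bg9Y (Matrix (Fin N) (Fin N) ℂ) (specialUnitaryUnits (Fin N)) x).Reg335 c35Y α₀ U →
        (bg9Y (Matrix (Fin N) (Fin N) ℂ) (specialUnitaryUnits (Fin N)) x).Reg336 c35Y α₀ U →
          BlockBd (g := toB6 (geo9Y x) 1 (H x)) (𝔬12 x).blk (𝔬12 x).blk
            (D2coK x.toKIdx (trBasis N) (bg9Y (Matrix (Fin N) (Fin N) ℂ) (specialUnitaryUnits (Fin N)) x) (fun U => U) ((resYOfC2 N θ Mstar 𝔠 x).Δ2) U)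
            (fun (y y' : (geo9Y x).Site) => θ₂ * ((geo9Y x).M * α₀) * ((geo9Y x).len y)⁻¹ * ((geo9Y x).len y')⁻¹ *
              Real.exp (-(δ₂ * (geo9Y x).dist y y'))) := by
  obtain ⟨ML, hsup⟩ := hD2sup_of_form_schemas_w q hq H 𝔠 𝔬12 bI hblk12 wC wH hwC hwH hww κC δC tHJ ρR δ₂ θ₂ M a hκC htHJ hρR hδ₂ hM hδC hθ₂ hC2 hHJ
  refine ⟨ML, fun x hMx hMM α₀ hα ha U hU hU' => ?_⟩
  have hgeo : GeoOK (geo9Y x) := ⟨geo9Y_dist_triangle x, geo9Y_dist_comm x, geo9K_dist_nonneg x.toKIdx, geo9Y_len_pos x⟩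
  have hθ : 0 ≤ θ₂ * ((geo9Y x).M * α₀) := mul_nonneg hθ₂0 (mul_nonneg (hM.le.trans hMM) hα.le)
  have hΔ := resYOfC2_Δ2_isSymmTr θ Mstar 𝔠 x (U := U) (fun μ z => specialUnitaryUnits_le_unitaryUnits (hU.1.1 μ z)) (hC x U hU.1.1) (hH x U hU.1.1)
  have h := hsup x hMx hMM α₀ hα ha U hU hU'
  rw [hblk12 x] at h ⊢
  exact blockBd_d2coK_of_sup_symm x.toKIdx (bg9Y (Matrix (Fin N) (Fin N) ℂ) (specialUnitaryUnits (Fin N)) x) (fun U => U)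
    ((resYOfC2 N θ Mstar 𝔠 x).Δ2) (R₀ := 1) (H₀ := H x) hgeo hθ h hΔ

end Summit.QuantumFields.YangMills.BalabanUVNodes.N06Delta2AtPinsC2Phys

end
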